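import Summits.Ventures.CertifiedArithmetic.LowPrec.AccumulateTree
import Summits.Ventures.CertifiedArithmetic.LowPrec.DirectedEnvelope
import Summits.Ventures.CertifiedArithmetic.LowPrec.GemmDirectedChains
import Literature.ComputerArithmetic.JeannerodRump2018.Theorem41

/-!
# Truncated (round-toward-zero) accumulation in any order: a first-order bound with no `O(u²)` term

HONEST FRAMING (venture CertifiedArithmetic / cell `pub-lowprec`): certified error envelopes and
provably optimal rounding/accumulation schemes for low-precision formats under stated cost models;
every table by two implementations; no hardware or vendor claims.

Summation with every addition rounded TOWARD ZERO (`roundTowardZero α`, file `Directed.lean`) in a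
format `α`, in ANY evaluation order (a `SumTree` of the typed Jeannerod–Rump file). Two elementary
facts drive everything: truncation never increases a magnitude (`abs_toRat_roundTowardZero_le`), so
every computed partial sum is bounded by the leaf sum below it (`abs_eval_rz_le_absSum`) — in
particular NO range hypothesis beyond `Σ|xᵢ| ≤ maxRat` is needed — and one truncated in-range sum of
two values has error `≤ 2u·|a + b|`, small sums being exact (`abs_err_roundTowardZero_add_le`).
Consequences, for leaves `xᵢ ∈ F_α` and `Σ|xᵢ| ≤ maxRat α` (every format, no `emaxCode` hypothesis):
* `Σ|eᵢ| ≤ 2u·(n-1)·Σ|xᵢ|` and `Σ|eᵢ| ≤ 2u·h·Σ|xᵢ|` (`h` = height; pairwise: `⌈log₂ n⌉`)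
  (`absErr_rz_le`, `absErr_rz_le_height`), hence the same bounds for `|ŝ - s|`
  (`abs_eval_rz_sub_exact_le`, `…_height`) — LINEAR in `n`/`h`, with no `(1+2u)^k - 1` or
  `γ_k(2u)` inflation [Higham2002ASNA, §4.2 gives the `γ` shapes for a general rounding];
* the recursive order in the cell's `seqSumWith` vocabulary (`GemmDirectedChains.lean`):
  `|ŝₙ| ≤ Σ|xᵢ|` and `|ŝₙ - Σxᵢ| ≤ 2u·n·Σ|xᵢ|` (`abs_seqSumWith_rz_sub_sum_le`) — the theorem-side
  envelope over the GEMM note's certified `RZ` rows (e.g. bfloat16 `W(n) = (n-2)/(286+n)` on the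
  truncation chain `36, 36, ¼, ¼, …`, kernel-replayed below for `n = 6`).
-/

namespace Literature.ComputerArithmetic.FloatingPoint

namespace MiniFloat

open Format Finset
open Literature.ComputerArithmetic.JeannerodRump2018
open Literature.ComputerArithmetic.JeannerodRump2018.SumTree

variable {α : Format}

/-! ### One truncated addition -/

/-- TRUNCATION IS A CONTRACTION: `|RZ x| ≤ |x|` for every rational `x` (no range hypothesis).
[cite: IEEE7542019, §4.3.2] -/
theorem abs_toRat_roundTowardZero_le (x : ℚ) : |(roundTowardZero α x).toRat| ≤ |x| := by
  have hq := α.quantum_pos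
  have hr : 0 ≤ |x| / α.quantum := div_nonneg (abs_nonneg x) hq.le
  have h1 := Format.rdGrid_le (φ := α) hr
  rw [le_div_iff₀ hq] at h1
  rw [toRat_roundTowardZero, abs_mul, abs_of_pos hq]
  refine le_trans (mul_le_mul_of_nonneg_right ?_ hq.le) h1
  split <;> simp

/-- A value of the format is truncated to itself. [folklore] -/
theorem toRat_roundTowardZero_toRat (y : MiniFloat α) :
    (roundTowardZero α y.toRat).toRat = y.toRat := by
  have hq := α.quantum_pos
  have hmag : |y.toRat| / α.quantum = y.scaledMag := by
    rw [abs_toRat, mul_div_cancel_right₀ _ (ne_of_gt hq)]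
  rw [toRat_roundTowardZero, hmag, Format.rdGrid_eq_self_of_representable y.representable_scaledMag]
  by_cases h : y.toRat < 0
  · rw [if_pos h]; have := abs_of_neg h; rw [abs_toRat] at this; linarith
  · rw [if_neg h]; have := abs_of_nonneg (not_lt.mp h); rw [abs_toRat] at this; linarith

/-- A rational that is the value of some datum is truncated to itself. [folklore] -/
theorem toRat_roundTowardZero_of_exists {t : ℚ} (h : ∃ y : MiniFloat α, y.toRat = t) :
    (roundTowardZero α t).toRat = t := by
  obtain ⟨y, rfl⟩ := h; exact toRat_roundTowardZero_toRat y

/-- ONE TRUNCATED ADDITION: for values `a, b` with `|a + b| ≤ maxRat`,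
`|RZ(a + b) - (a + b)| ≤ 2u·|a + b|` — sums below `2^(m+1)` quanta are values (exact), larger ones
are in the normal range where truncation loses less than one ulp `≤ 2u·|a+b|`. Every format.
[cite: Higham2002ASNA, §2.6 and (2.5)] -/
theorem abs_err_roundTowardZero_add_le (a b : MiniFloat α) (h : |a.toRat + b.toRat| ≤ α.maxRat) :
    |(roundTowardZero α (a.toRat + b.toRat)).toRat - (a.toRat + b.toRat)|
      ≤ 2 * α.unitRoundoff * |a.toRat + b.toRat| := by
  have hq := α.quantum_pos
  have hu := α.unitRoundoff_pos
  by_cases hsmall : |a.toRat + b.toRat| < 2 ^ (α.manBits + 1) * α.quantum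
  · -- the sum is a value: exact
    have hex : ∃ y : MiniFloat α, y.toRat = a.toRat + b.toRat := by
      rw [toRat_add_toRat] at h hsmall ⊢
      set N : ℤ := a.toInt + b.toInt with hN
      have hcast : ((N.natAbs : ℕ) : ℚ) = |(N : ℚ)| := by rw [Nat.cast_natAbs, Int.cast_abs]
      rw [abs_mul, abs_of_pos hq, ← hcast] at h hsmall
      have hNlt : N.natAbs < 2 ^ (α.manBits + 1) := by
        have : ((N.natAbs : ℕ) : ℚ) < 2 ^ (α.manBits + 1) := lt_of_mul_lt_mul_right hsmall hq.le
        exact_mod_cast this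
      have hNle : N.natAbs ≤ α.maxScaled := by
        unfold Format.maxRat at h
        exact_mod_cast le_of_mul_le_mul_right h hq
      exact exists_toRat_eq_int_mul_quantum hNlt hNle
    rw [toRat_roundTowardZero_of_exists hex, sub_self, abs_zero]
    positivity
  · have hlo : 2 ^ α.manBits * α.quantum ≤ |a.toRat + b.toRat| := by
      refine le_trans ?_ (not_lt.mp hsmall)
      rw [pow_succ]
      nlinarith [pow_pos (show (0:ℚ) < 2 by norm_num) α.manBits]
    rw [abs_sub_comm]
    exact (abs_sub_roundTowardZero_lt_two_mul hlo h).le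

/-! ### Any evaluation order -/

/-- PARTIAL SUMS NEVER EXCEED THE LEAF SUM: `|ŝ_T| ≤ Σ_{leaves of T} |xᵢ|` for truncated evaluation,
unconditionally. [folklore] -/
theorem abs_eval_rz_le_absSum : ∀ t : SumTree,
    |SumTree.eval (fun y => (roundTowardZero α y).toRat) t| ≤ absSum t
  | .leaf x => by simp [SumTree.eval, absSum, SumTree.leaves]
  | .node l r => by
      rw [absSum_node]
      simp only [SumTree.eval]
      exact le_trans (abs_toRat_roundTowardZero_le _) (le_trans (abs_add_le _ _)
        (add_le_add (abs_eval_rz_le_absSum l) (abs_eval_rz_le_absSum r)))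

/-- Every evaluated subtree is a value when the leaves are. [folklore] -/
theorem exists_toRat_eq_eval_rz (t : SumTree) (h : ∀ x ∈ t.leaves, ∃ y : MiniFloat α, y.toRat = x) :
    ∃ y : MiniFloat α, y.toRat = SumTree.eval (fun y => (roundTowardZero α y).toRat) t := by
  cases t with
  | leaf x => simpa [SumTree.eval, SumTree.leaves] using h
  | node l r => exact ⟨roundTowardZero α _, rfl⟩

/-- The local error at a node is at most `2u` times the leaf sum below it. [folklore] -/
theorem abs_localErr_rz_le (l r : SumTree)
    (hl : ∀ x ∈ l.leaves, ∃ y : MiniFloat α, y.toRat = x)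
    (hr : ∀ x ∈ r.leaves, ∃ y : MiniFloat α, y.toRat = x) (hS : absSum l + absSum r ≤ α.maxRat) :
    |(roundTowardZero α (SumTree.eval (fun y => (roundTowardZero α y).toRat) l
        + SumTree.eval (fun y => (roundTowardZero α y).toRat) r)).toRat
      - (SumTree.eval (fun y => (roundTowardZero α y).toRat) l
        + SumTree.eval (fun y => (roundTowardZero α y).toRat) r)|
      ≤ 2 * α.unitRoundoff * (absSum l + absSum r) := by
  obtain ⟨yl, hyl⟩ := exists_toRat_eq_eval_rz l hl
  obtain ⟨yr, hyr⟩ := exists_toRat_eq_eval_rz r hr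
  have hb : |yl.toRat + yr.toRat| ≤ absSum l + absSum r := by
    rw [hyl, hyr]
    exact le_trans (abs_add_le _ _) (add_le_add (abs_eval_rz_le_absSum l) (abs_eval_rz_le_absSum r))
  have h := abs_err_roundTowardZero_add_le yl yr (le_trans hb hS)
  rw [hyl, hyr] at h hb
  exact le_trans h (mul_le_mul_of_nonneg_left hb (by have := α.unitRoundoff_pos; positivity))

/-- ANY ORDER, LEAF-COUNT FORM: leaves in `F_α`, `Σ|xᵢ| ≤ maxRat` ⟹ `Σ|eᵢ| ≤ 2u·(n-1)·Σ|xᵢ|`.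
[folklore] -/
theorem absErr_rz_le : ∀ t : SumTree, (∀ x ∈ t.leaves, ∃ y : MiniFloat α, y.toRat = x) →
    absSum t ≤ α.maxRat →
      absErr (fun y => (roundTowardZero α y).toRat) t
        ≤ 2 * α.unitRoundoff * ((t.leaves.length : ℚ) - 1) * absSum t
  | .leaf x, _, _ => by simp [absErr, SumTree.localErrors, SumTree.leaves]
  | .node l r, hleaves, hS => by
      have hl : ∀ x ∈ l.leaves, ∃ y : MiniFloat α, y.toRat = x :=
        fun x hx => hleaves x (by simp [SumTree.leaves, hx])
      have hr : ∀ x ∈ r.leaves, ∃ y : MiniFloat α, y.toRat = x :=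
        fun x hx => hleaves x (by simp [SumTree.leaves, hx])
      have hSl := absSum_nonneg l
      have hSr := absSum_nonneg r
      rw [absSum_node] at hS
      have ihl := absErr_rz_le l hl (by linarith)
      have ihr := absErr_rz_le r hr (by linarith)
      have hloc := abs_localErr_rz_le l r hl hr hS
      have hu := α.unitRoundoff_pos
      rw [absErr_node, absSum_node]
      have hlen : ((SumTree.node l r).leaves.length : ℚ) = l.leaves.length + r.leaves.length := by
        simp [SumTree.leaves, List.length_append]
      rw [hlen]
      have hn1 : (1 : ℚ) ≤ l.leaves.length := by exact_mod_cast one_le_length_leaves l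
      have hn2 : (1 : ℚ) ≤ r.leaves.length := by exact_mod_cast one_le_length_leaves r
      set n1 : ℚ := (l.leaves.length : ℚ)
      set n2 : ℚ := (r.leaves.length : ℚ)
      set S1 := absSum l
      set S2 := absSum r
      have t1 : 0 ≤ 2 * α.unitRoundoff * ((n2 - 1) * S1 + (n1 - 1) * S2) := by
        have : 0 ≤ (n2 - 1) * S1 + (n1 - 1) * S2 :=
          add_nonneg (mul_nonneg (by linarith) hSl) (mul_nonneg (by linarith) hSr)
        positivity
      nlinarith

/-- ANY ORDER, HEIGHT FORM: leaves in `F_α`, `Σ|xᵢ| ≤ maxRat` ⟹ `Σ|eᵢ| ≤ 2u·h·Σ|xᵢ|` with `h` the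
height of the evaluation tree (pairwise summation: `h = ⌈log₂ n⌉`). [folklore] -/
theorem absErr_rz_le_height : ∀ t : SumTree, (∀ x ∈ t.leaves, ∃ y : MiniFloat α, y.toRat = x) →
    absSum t ≤ α.maxRat →
      absErr (fun y => (roundTowardZero α y).toRat) t
        ≤ 2 * α.unitRoundoff * (treeHeight t : ℚ) * absSum t
  | .leaf x, _, _ => by simp [absErr, SumTree.localErrors, treeHeight]
  | .node l r, hleaves, hS => by
      have hl : ∀ x ∈ l.leaves, ∃ y : MiniFloat α, y.toRat = x :=
        fun x hx => hleaves x (by simp [SumTree.leaves, hx])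
      have hr : ∀ x ∈ r.leaves, ∃ y : MiniFloat α, y.toRat = x :=
        fun x hx => hleaves x (by simp [SumTree.leaves, hx])
      have hSl := absSum_nonneg l
      have hSr := absSum_nonneg r
      rw [absSum_node] at hS
      have ihl := absErr_rz_le_height l hl (by linarith)
      have ihr := absErr_rz_le_height r hr (by linarith)
      have hloc := abs_localErr_rz_le l r hl hr hS
      have hu := α.unitRoundoff_pos
      rw [absErr_node, absSum_node]
      simp only [treeHeight]
      rw [Nat.cast_add, Nat.cast_one]
      set H : ℕ := max (treeHeight l) (treeHeight r) with hH
      have hHl : (treeHeight l : ℚ) ≤ (H : ℚ) := by exact_mod_cast le_max_left _ _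
      have hHr : (treeHeight r : ℚ) ≤ (H : ℚ) := by exact_mod_cast le_max_right _ _
      have i1 : absErr (fun y => (roundTowardZero α y).toRat) l ≤ 2 * α.unitRoundoff * H * absSum l :=
        le_trans ihl (by gcongr)
      have i2 : absErr (fun y => (roundTowardZero α y).toRat) r ≤ 2 * α.unitRoundoff * H * absSum r :=
        le_trans ihr (by gcongr)
      have e : 2 * α.unitRoundoff * ((H : ℚ) + 1) * (absSum l + absSum r)
          = 2 * α.unitRoundoff * H * absSum l + 2 * α.unitRoundoff * H * absSum r
            + 2 * α.unitRoundoff * (absSum l + absSum r) := by ring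
      rw [e]
      linarith

/-- `|ŝ - s| ≤ 2u·(n-1)·Σ|xᵢ|` for truncated summation in any order (leaves in `F_α`,
`Σ|xᵢ| ≤ maxRat`). [folklore] -/
theorem abs_eval_rz_sub_exact_le (t : SumTree) (ht : ∀ x ∈ t.leaves, ∃ y : MiniFloat α, y.toRat = x)
    (hS : absSum t ≤ α.maxRat) :
    |SumTree.eval (fun y => (roundTowardZero α y).toRat) t - SumTree.exact t|
      ≤ 2 * α.unitRoundoff * ((t.leaves.length : ℚ) - 1) * absSum t :=
  le_trans (abs_eval_sub_exact_le _ t) (absErr_rz_le t ht hS)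

/-- `|ŝ - s| ≤ 2u·h·Σ|xᵢ|`, `h` the height of the evaluation tree. [folklore] -/
theorem abs_eval_rz_sub_exact_le_height (t : SumTree)
    (ht : ∀ x ∈ t.leaves, ∃ y : MiniFloat α, y.toRat = x) (hS : absSum t ≤ α.maxRat) :
    |SumTree.eval (fun y => (roundTowardZero α y).toRat) t - SumTree.exact t|
      ≤ 2 * α.unitRoundoff * (treeHeight t : ℚ) * absSum t :=
  le_trans (abs_eval_sub_exact_le _ t) (absErr_rz_le_height t ht hS)

/-! ### The recursive order (`seqSumWith (roundTowardZero α)`) -/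

/-- RECURSIVE TRUNCATED SUMMATION: for `x₀ … xₙ ∈ F_α` with `Σ|xᵢ| ≤ maxRat`, the partial sum never
exceeds `Σ|xᵢ|` and `|ŝₙ - Σxᵢ| ≤ 2u·n·Σ|xᵢ|` (`n` additions). [folklore] -/
theorem abs_seqSumWith_rz_sub_sum_le (x : ℕ → ℚ) :
    ∀ n, (∀ i ≤ n, ∃ y : MiniFloat α, y.toRat = x i) → ∑ i ∈ range (n + 1), |x i| ≤ α.maxRat →
      |(seqSumWith (roundTowardZero α) x n).toRat| ≤ ∑ i ∈ range (n + 1), |x i| ∧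
      |(seqSumWith (roundTowardZero α) x n).toRat - ∑ i ∈ range (n + 1), x i|
        ≤ 2 * α.unitRoundoff * n * ∑ i ∈ range (n + 1), |x i|
  | 0, hx, _ => by
      have h0 : (seqSumWith (roundTowardZero α) x 0).toRat = x 0 :=
        toRat_roundTowardZero_of_exists (hx 0 le_rfl)
      simp [h0]
  | n + 1, hx, hL => by
      have hu := α.unitRoundoff_pos
      have hL' : ∑ i ∈ range (n + 1), |x i| ≤ ∑ i ∈ range (n + 1 + 1), |x i| := by
        rw [sum_range_succ (fun i => |x i|) (n + 1)]; linarith [abs_nonneg (x (n + 1))]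
      obtain ⟨ih1, ih2⟩ := abs_seqSumWith_rz_sub_sum_le x n (fun i hi => hx i (Nat.le_succ_of_le hi))
        (le_trans hL' hL)
      obtain ⟨yk, hyk⟩ := hx (n + 1) le_rfl
      set ŝ := seqSumWith (roundTowardZero α) x n with hŝ
      have hstep : seqSumWith (roundTowardZero α) x (n + 1) = roundTowardZero α (ŝ.toRat + x (n + 1)) := rfl
      have harg : |ŝ.toRat + x (n + 1)| ≤ ∑ i ∈ range (n + 1 + 1), |x i| := by
        rw [sum_range_succ (fun i => |x i|) (n + 1)]
        exact le_trans (abs_add_le _ _) (by linarith)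
      have hloc := abs_err_roundTowardZero_add_le ŝ yk (by rw [hyk]; exact le_trans harg hL)
      rw [hyk] at hloc
      rw [hstep]
      constructor
      · exact le_trans (abs_toRat_roundTowardZero_le _) harg
      · rw [sum_range_succ (fun i => x i) (n + 1)]
        have hL0 : 0 ≤ ∑ i ∈ range (n + 1 + 1), |x i| := sum_nonneg fun _ _ => abs_nonneg _
        have e : (roundTowardZero α (ŝ.toRat + x (n + 1))).toRat - (∑ i ∈ range (n + 1), x i + x (n + 1))
            = ((roundTowardZero α (ŝ.toRat + x (n + 1))).toRat - (ŝ.toRat + x (n + 1)))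
              + (ŝ.toRat - ∑ i ∈ range (n + 1), x i) := by ring
        rw [e]
        refine le_trans (abs_add_le _ _) ?_
        have h1 : |(roundTowardZero α (ŝ.toRat + x (n + 1))).toRat - (ŝ.toRat + x (n + 1))|
            ≤ 2 * α.unitRoundoff * ∑ i ∈ range (n + 1 + 1), |x i| :=
          le_trans hloc (mul_le_mul_of_nonneg_left harg (by positivity))
        have h2 : |ŝ.toRat - ∑ i ∈ range (n + 1), x i| ≤ 2 * α.unitRoundoff * n * ∑ i ∈ range (n + 1 + 1), |x i| :=
          le_trans ih2 (mul_le_mul_of_nonneg_left hL' (by positivity))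
        push_cast
        nlinarith

/-- Kernel replay (bfloat16, `u = 2^-8`, toward zero): the GEMM note's truncation chain
`36, 36, ¼, ¼, ¼, ¼` — `36 + 36 = 72` is exact and every further `72 + ¼` truncates back to `72`
(spacing `½`), so after `n = 6` summands `ŝ = 72` against the exact `73`: error `1 = (n-2)/4`,
ratio `(n-2)/(286+n) = 1/73` of `Σ|xᵢ| = 73`, inside the envelope `2u·5·73 ≈ 2.85`. [folklore] -/
theorem seqSumWith_rz_BFloat16_chain :
    (seqSumWith (roundTowardZero Format.BFloat16) (fun i => if i < 2 then 36 else 1 / 4) 5).toRat = 72 := by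
  decide +kernel

end MiniFloat

end Literature.ComputerArithmetic.FloatingPoint
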